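import Literature.NumberTheory.GaloisRepresentations.LocalWeilDatumUnramified
import Literature.NumberTheory.GaloisRepresentations.LocalWeilDatumNorm
import Literature.NumberTheory.GaloisRepresentations.LocalWeilDatumDegree
import Literature.NumberTheory.GaloisRepresentations.LocalWeilDatumExtensionValuation
import Literature.NumberTheory.GaloisRepresentations.WeilGroupFrobeniusPowers
import Literature.NumberTheory.GaloisRepresentations.AbsGaloisGroupOpenNormal
import Mathlib.FieldTheory.KrullTopology
import HarnessLib

/-!
# Open subgroups of finite index of the Weil group are Weil groups of finite extensions

Topic `NumberTheory/GaloisRepresentations`; namespace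
`Literature.NumberTheory.GaloisRepresentations.LocalWeilDatum` (the vocabulary of
`LocalWeilDatum*.lean`: `galFixing F K = G_K ≤ Γ_F`, `fieldSubgroup F K = W_F ∩ G_K ≤ W_F`,
`IsFieldSubgroup F U` — "`U = W_F ∩ G_K` for a finite separable `K ⊆ F̄`").  Let `F` be a
non-archimedean local field, `W_F = WeilGroup F` its Weil group with the Weil topology
(`WeilGroup.instTopologicalSpace`: `I_F` open and profinite).  This file supplies the
Galois-theoretic dictionary used in the uniqueness of the Langlands–Deligne local constants
(Deligne, *Les constantes des équations fonctionnelles des fonctions `L`*, Antwerp II (1973), §4: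
a continuous representation of `W_F` with open kernel of finite index is a representation of a
finite quotient `W_F / (W_F ∩ G_K)`, and the subgroups of that quotient are the `W_F ∩ G_M` of the
finite separable `M/F`, i.e. the images of the Weil groups `W_M → W_F`).  Everything is **proved**:

* `LocalWeilDatum.exists_inertia_inf_fieldSubgroup_le` — an open subgroup `K ≤ W_F` contains
  `I_F ∩ (W_F ∩ G_L)` for some finite *separable* `L ⊆ F̄` (local structure of the Weil topology,
  `WeilGroup.exists_isOpen_inter_inertia_eq`; a Krull neighbourhood of `1` contains some `G_L`,
  `krullTopology_mem_nhds_one_iff`; and `G_L = G_{L_s}` for the separable closure `L_s` of `F` in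
  `L`, `apply_eq_self_of_forall_mem_separableClosure`).
* `LocalWeilDatum.isFieldSubgroup_of_isOpen_of_finiteIndex` — **an open subgroup of finite index
  of `W_F` is a field subgroup** `W_F ∩ G_K`, `K/F` finite separable (Tate, Corvallis 1979, (1.4.4):
  the closed subgroups of finite index of `W_F` are those of the form `W_E`; Bushnell–Henniart,
  *The local Langlands conjecture for GL(2)*, §28.5 Proposition (2)).  Proof: with `L` as above and
  an arithmetic Frobenius `Φ`, some `Φ ^ m` (`m ≥ 1`) lies in the finite-index subgroup
  `K ∩ (W_F ∩ G_L)`; then the field subgroup `(W_F ∩ G_L) ∩ deg⁻¹(mℤ)` (intersection of `G_L`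
  with the unramified level `deg⁻¹(mℤ) = W_F ∩ G_{F_m}`, `isFieldSubgroup_degMultiples`) lies in
  `K` (`w = (w Φ^{-deg w}) · Φ^{deg w}` with the first factor in `I_F ∩ G_L`), and over-groups of
  field subgroups are field subgroups (`isFieldSubgroup_of_le`).
* `LocalWeilDatum.galFixing_map_eq_conjSub`, `LocalWeilDatum.exists_fieldSubgroup_map_eq_conjSub`
  — `G_{σK} = σ G_K σ⁻¹`, and for `K/F` finite the Weil subgroup of a `Γ_F`-conjugate `σ K` is a
  `W_F`-conjugate `w (W_F ∩ G_K) w⁻¹` (`W_F` meets the coset `σ G_K`, density of `W_F` in `Γ_F`).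
* `LocalWeilDatum.exists_embField_eq_map` — for a subfield `M ⊆ F̄` the copy
  `embField F M = ι⁻¹(M) ⊆ F̄` of the abstract field `↥M` used by `LocalWeilDatumExtension*`
  (through the chosen embedding `ι : F̄ → M̄`) is a `Γ_F`-conjugate `σ M` of `M`
  (extension of `F`-embeddings to `F̄`, `AlgHom.liftNormal`).
* `mem_weilSubgroup_of_absGaloisRestrict_mem` — for a finite extension `E/F` of local fields with
  compatible valuations, an element of `Γ_E` whose restriction to `F̄` lies in `W_F` lies in `W_E`
  (converse of `WeilGroup.weilSubgroup_map_absGaloisRestrict_le`: `deg_F = f · deg_E`, the residue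
  degree `f` divides the degree of every element of `W_F ∩ G_{E₀}`,
  `inertiaDeg_dvd_deg_of_mem_fieldSubgroup`, and `q_E = q_F ^ f`,
  `residueFieldCard_eq_pow_inertiaDeg`; transport of the Frobenius congruences along `ι`).
* `WeilGroup.range_map_eq_fieldSubgroup_embField` — **the image of `W_E → W_F` is the field
  subgroup `W_F ∩ G_{E₀}`** of `E₀ = embField F E` (Tate, Corvallis 1979, (1.4.5):
  `W_E = Gal(F̄/E) ∩ W_F`... read through `res : Γ_E ≅ G_{E₀}`).

No definitions, no named facts (D-0026).

## Mathlib

USED: `krullTopology_mem_nhds_one_iff`, `IntermediateField.lift`, `IntermediateField.liftAlgEquiv`,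
`separableClosure`, `IsSeparable.map`, `Subgroup.index_inf_ne_zero`,
`Subgroup.exists_pow_mem_of_index_ne_zero`, `AlgHom.liftNormal`, `AlgHom.liftNormal_commutes`,
`Algebra.IsAlgebraic.algHom_bijective`, `Set.mem_smul_set`.  Mathlib has no Weil groups.

## References

* J. Tate, *Number theoretic background*, in: Automorphic forms, representations and `L`-functions
  (Corvallis 1977), Proc. Sympos. Pure Math. 33.2 (1979), (1.4.1)–(1.4.5). [Corvallis1979]
* P. Deligne, *Les constantes des équations fonctionnelles des fonctions `L`*, Antwerp II,
  LNM 349 (1973), §2.2, §4. [Deligne1973]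
* J. Neukirch, *Algebraic Number Theory*, Springer 1999, Ch. IV §4 (the fields `W ∩ G_K` of a
  Weil datum). [NeukirchANT1999]
-/

noncomputable section

open Field ValuativeRel
open scoped Pointwise Valued

namespace Literature.NumberTheory.GaloisRepresentations

open GaloisRepresentations.IsNonarchimedeanLocalField

namespace LocalWeilDatum

open AbstractCFT

section OpenFiniteIndex

variable (F : Type*) [Field F] [ValuativeRel F] [TopologicalSpace F] [IsNonarchimedeanLocalField F]

omit [ValuativeRel F] [TopologicalSpace F] [IsNonarchimedeanLocalField F] in
/-- `G_{L_s} ≤ G_L` for the separable closure `L_s` of `F` in a subfield `L ⊆ F̄`: an automorphism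
fixing `L_s` pointwise fixes `L` pointwise (`L/L_s` is purely inseparable). [folklore] -/
theorem galFixing_lift_separableClosure_le (L : IntermediateField F (AlgebraicClosure F)) :
    galFixing F (IntermediateField.lift (separableClosure F L)) ≤ galFixing F L := by
  intro σ hσ
  rw [mem_galFixing_iff] at hσ ⊢
  intro x hx
  exact apply_eq_self_of_forall_mem_separableClosure L (absoluteGaloisGroup.toAlgEquiv F σ)
    (fun y hy => hσ y hy) x hx

omit [ValuativeRel F] [TopologicalSpace F] [IsNonarchimedeanLocalField F] in
/-- The separable closure of `F` in a subfield `L ⊆ F̄` lies in `F^sep`. [folklore] -/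
theorem lift_separableClosure_le_sepClosure (L : IntermediateField F (AlgebraicClosure F)) :
    IntermediateField.lift (separableClosure F L) ≤ sepClosure F := by
  intro y hy
  rw [IntermediateField.lift, IntermediateField.mem_map] at hy
  obtain ⟨x, hx, rfl⟩ := hy
  rw [mem_separableClosure_iff] at hx
  exact mem_separableClosure_iff.mpr (IsSeparable.map L.val (fun a b h => Subtype.ext h) hx)

/-- **An open subgroup of `W_F` contains `I_F ∩ G_L` for a finite separable `L ⊆ F̄`.**  A Weil-open
set meets `I_F` in the trace of a Krull-open set (`WeilGroup.exists_isOpen_inter_inertia_eq`), a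
Krull neighbourhood of `1` contains `G_L` for a finite `L` (`krullTopology_mem_nhds_one_iff`), and
`L` may be replaced by the separable closure of `F` in `L` (`galFixing_lift_separableClosure_le`).
[cite: Corvallis1979, (1.4.1)] -/
theorem exists_inertia_inf_fieldSubgroup_le (K : Subgroup (WeilGroup F))
    (hK : IsOpen (K : Set (WeilGroup F))) :
    ∃ L : IntermediateField F (AlgebraicClosure F), FiniteDimensional F L ∧ L ≤ sepClosure F ∧
      WeilGroup.inertia F ⊓ fieldSubgroup F L ≤ K := by
  obtain ⟨V, hV, hKV⟩ := WeilGroup.exists_isOpen_inter_inertia_eq hK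
  have h1 : (1 : WeilGroup F) ∈ (K : Set (WeilGroup F)) ∩ (WeilGroup.inertia F : Set (WeilGroup F)) :=
    ⟨K.one_mem, (WeilGroup.inertia F).one_mem⟩
  rw [hKV] at h1
  have h1V : (1 : absoluteGaloisGroup F) ∈ V := by simpa using h1.2
  obtain ⟨L, hL, hLV⟩ :=
    (krullTopology_mem_nhds_one_iff F (AlgebraicClosure F) V).mp (hV.mem_nhds h1V)
  haveI := hL
  set Ls : IntermediateField F (AlgebraicClosure F) := IntermediateField.lift (separableClosure F L)
    with hLs
  haveI hLsfin : FiniteDimensional F Ls :=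
    LinearEquiv.finiteDimensional
      (IntermediateField.liftAlgEquiv (separableClosure F L)).toLinearEquiv
  refine ⟨Ls, hLsfin, lift_separableClosure_le_sepClosure F L, fun x hx => ?_⟩
  obtain ⟨hxI, hxL⟩ := Subgroup.mem_inf.mp hx
  have hxL' : WeilGroup.toAbsGalois F x ∈ galFixing F L :=
    galFixing_lift_separableClosure_le F L ((toAbsGalois_mem_galFixing_iff (F := F)).mpr hxL)
  have hx' : x ∈ (K : Set (WeilGroup F)) ∩ (WeilGroup.inertia F : Set (WeilGroup F)) := by
    rw [hKV]
    refine ⟨hxI, hLV ?_⟩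
    rw [SetLike.mem_coe, IntermediateField.mem_fixingSubgroup_iff]
    intro y hy
    exact (mem_galFixing_iff F).mp hxL' y hy
  exact hx'.1

/-- **Open subgroups of finite index of `W_F` are field subgroups** `W_F ∩ G_K`, `K/F` finite
separable: with `I_F ∩ G_L ⊆ K` (`exists_inertia_inf_fieldSubgroup_le`), an arithmetic Frobenius
`Φ` and `m ≥ 1` with `Φ ^ m ∈ K ∩ G_L` (finite index), the field subgroup
`(W_F ∩ G_L) ∩ deg⁻¹(mℤ)` lies in `K` — for `w` in it, `w = (w Φ^{-deg w}) Φ^{deg w}` with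
`w Φ^{-deg w} ∈ I_F ∩ G_L ⊆ K` and `Φ^{deg w} ∈ K` —, and over-groups of field subgroups are field
subgroups (`isFieldSubgroup_of_le`).
[cite: Corvallis1979, (1.4.4)] -/
theorem isFieldSubgroup_of_isOpen_of_finiteIndex (K : Subgroup (WeilGroup F))
    (hK : IsOpen (K : Set (WeilGroup F))) [hKi : K.FiniteIndex] : IsFieldSubgroup F K := by
  obtain ⟨L, hL, hLs, hIL⟩ := exists_inertia_inf_fieldSubgroup_le F K hK
  haveI := hL
  haveI : (fieldSubgroup F L).FiniteIndex := finiteIndex_fieldSubgroup F L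
  obtain ⟨Φ, hΦ⟩ := exists_degZ_eq_one F
  rw [degZ_degHom] at hΦ
  have hidx : (K ⊓ fieldSubgroup F L).index ≠ 0 :=
    Subgroup.index_inf_ne_zero hKi.index_ne_zero Subgroup.FiniteIndex.index_ne_zero
  obtain ⟨m, hm0, -, hΦm⟩ := Subgroup.exists_pow_mem_of_index_ne_zero hidx Φ
  obtain ⟨hΦK, hΦL⟩ := Subgroup.mem_inf.mp hΦm
  have hU : IsFieldSubgroup F (fieldSubgroup F L ⊓ degMultiples (degHom F) m) :=
    isFieldSubgroup_inf F ⟨L, hL, hLs, rfl⟩ (isFieldSubgroup_degMultiples F m hm0)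
  refine isFieldSubgroup_of_le F hU ?_
  intro w hw
  obtain ⟨hwL, hwm⟩ := Subgroup.mem_inf.mp hw
  rw [mem_degMultiples_iff, degZ_degHom] at hwm
  obtain ⟨a, ha⟩ := hwm
  set u : WeilGroup F := w * (Φ ^ m) ^ (-a) with hu
  have hudeg : WeilGroup.deg u = 0 := by
    rw [hu, WeilGroup.deg_mul IsFrobPow.mul_holds IsFrobPow.unique_holds, WeilGroup.deg_zpow,
      WeilGroup.deg_pow, hΦ, ha]
    ring
  have huI : u ∈ WeilGroup.inertia F :=
    (WeilGroup.deg_eq_zero_iff_mem_inertia IsFrobPow.mul_holds IsFrobPow.unique_holds).mp hudeg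
  have huL : u ∈ fieldSubgroup F L := mul_mem hwL (zpow_mem hΦL _)
  have huK : u ∈ K := hIL (Subgroup.mem_inf.mpr ⟨huI, huL⟩)
  have hwu : w = u * (Φ ^ m) ^ a := by rw [hu, mul_assoc, ← zpow_add, neg_add_cancel, zpow_zero, mul_one]
  rw [hwu]
  exact K.mul_mem huK (K.zpow_mem hΦK a)

/-- **`(W_F : W_F ∩ G_K) = [K : F]`** for `K ⊆ F^sep` finite: the cosets correspond to the
`F`-embeddings `K → F̄` (`bijective_embOf_out`), counted by `AlgHom.card`.
[cite: NeukirchANT1999, Ch. IV §4 (`[L : K] = (G_K : G_L)`)] -/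
theorem index_fieldSubgroup_eq_finrank (K : IntermediateField F (AlgebraicClosure F))
    [FiniteDimensional F K] (hKs : K ≤ sepClosure F) :
    (fieldSubgroup F K).index = Module.finrank F K := by
  classical
  haveI : Algebra.IsSeparable F K := (le_separableClosure_iff F (AlgebraicClosure F) K).mp hKs
  rw [← Subgroup.relIndex_top_right, Subgroup.relIndex, ← AlgHom.card F K (AlgebraicClosure F),
    ← Nat.card_eq_fintype_card, ← Nat.card_eq_of_bijective _ (bijective_embOf_out F K)]
  rfl

/-- An open subgroup of finite index of `W_F` has the form `W_F ∩ G_K` with `K/F` finite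
separable; recorded with the witness field (unfolded `IsFieldSubgroup`). [cite: Corvallis1979, (1.4.4)] -/
theorem exists_eq_fieldSubgroup_of_isOpen_of_finiteIndex (K : Subgroup (WeilGroup F))
    (hK : IsOpen (K : Set (WeilGroup F))) [K.FiniteIndex] :
    ∃ M : IntermediateField F (AlgebraicClosure F), FiniteDimensional F M ∧ M ≤ sepClosure F ∧
      K = fieldSubgroup F M :=
  isFieldSubgroup_of_isOpen_of_finiteIndex F K hK

/-! ### Conjugate subfields -/

omit [ValuativeRel F] [TopologicalSpace F] [IsNonarchimedeanLocalField F] in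
/-- `G_{σ K} = σ G_K σ⁻¹` for `σ ∈ Γ_F`. [folklore] -/
theorem galFixing_map_eq_conjSub (K : IntermediateField F (AlgebraicClosure F))
    (σ : absoluteGaloisGroup F) :
    galFixing F (K.map (absoluteGaloisGroup.toAlgEquiv F σ : AlgebraicClosure F →ₐ[F] AlgebraicClosure F)) =
      conjSub σ (galFixing F K) := by
  ext τ
  rw [mem_conjSub_iff, mem_galFixing_iff, mem_galFixing_iff]
  constructor
  · intro h x hx
    have := h (σ • x) (by
      rw [IntermediateField.mem_map]
      exact ⟨x, hx, rfl⟩)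
    rw [mul_smul, mul_smul, inv_smul_eq_iff]
    exact this
  · intro h y hy
    rw [IntermediateField.mem_map] at hy
    obtain ⟨x, hx, rfl⟩ := hy
    have := h x hx
    rw [mul_smul, mul_smul, inv_smul_eq_iff] at this
    exact this

/-- **Conjugate finite subfields have `W_F`-conjugate Weil subgroups**: for `K/F` finite and
`σ ∈ Γ_F` there is `w ∈ W_F` with `W_F ∩ G_{σK} = w (W_F ∩ G_K) w⁻¹` — `W_F` is dense in `Γ_F`, so
it meets the open coset `σ G_K` in some `w = σ g`, and `σ G_K σ⁻¹ = w G_K w⁻¹`.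
[cite: Corvallis1979, (1.4.1)] -/
theorem exists_fieldSubgroup_map_eq_conjSub (K : IntermediateField F (AlgebraicClosure F))
    [FiniteDimensional F K] (σ : absoluteGaloisGroup F) :
    ∃ w : WeilGroup F,
      fieldSubgroup F (K.map (absoluteGaloisGroup.toAlgEquiv F σ : AlgebraicClosure F →ₐ[F] AlgebraicClosure F)) =
        conjSub w (fieldSubgroup F K) := by
  obtain ⟨w, hw⟩ := exists_toAbsGalois_mem_smul_galFixing F K σ
  obtain ⟨g, hg, hwg⟩ := Set.mem_smul_set.mp hw
  refine ⟨w, ?_⟩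
  ext τ
  rw [fieldSubgroup, Subgroup.mem_comap, galFixing_map_eq_conjSub, mem_conjSub_iff, mem_conjSub_iff,
    fieldSubgroup, Subgroup.mem_comap, map_mul, map_mul, map_inv, ← hwg, smul_eq_mul]
  have e : (σ * g)⁻¹ * WeilGroup.toAbsGalois F τ * (σ * g) =
      g⁻¹ * (σ⁻¹ * WeilGroup.toAbsGalois F τ * σ) * g := by group
  rw [e]
  constructor
  · intro h
    exact mul_mem (mul_mem (inv_mem hg) h) hg
  · intro h
    have := mul_mem (mul_mem hg h) (inv_mem hg)
    rwa [← mul_assoc, ← mul_assoc, mul_inv_cancel, one_mul, mul_assoc, mul_inv_cancel, mul_one] at this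

end OpenFiniteIndex

/-! ### The copy `E₀ = ι⁻¹(E)` of a subfield `E = M ⊆ F̄` is a conjugate of `M` -/

section EmbField

variable (F : Type*) [Field F]

/-- For a subfield `M ⊆ F̄`, the subfield `embField F M = ι⁻¹(M) ⊆ F̄` attached to the abstract field
`↥M` through the chosen embedding `ι : F̄ → closure(M)` is `σ M` for some `σ ∈ Γ_F`: the two
`F`-embeddings `M ⊆ F̄` and `M ≅ E₀ ⊆ F̄` differ by an automorphism of the normal extension `F̄/F`
(`AlgHom.liftNormal`, bijective since `F̄/F` is algebraic). [folklore] -/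
theorem exists_embField_eq_map (M : IntermediateField F (AlgebraicClosure F)) :
    ∃ σ : absoluteGaloisGroup F,
      embField F M = M.map (absoluteGaloisGroup.toAlgEquiv F σ : AlgebraicClosure F →ₐ[F] AlgebraicClosure F) := by
  -- the embedding `j : M → F̄`, `x ↦ ι⁻¹ x`, with image `E₀`
  let j : M →ₐ[F] AlgebraicClosure F := (embField F M).val.comp (equivEmbField F M).toAlgHom
  have hj : ∀ x : M, j x = ((equivEmbField F M x : embField F M) : AlgebraicClosure F) := fun x => rfl
  -- extend `j` to an automorphism of `F̄`
  let σ₀ : AlgebraicClosure F →ₐ[F] AlgebraicClosure F := j.liftNormal (AlgebraicClosure F)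
  have hσ₀ : ∀ x : M, σ₀ (x : AlgebraicClosure F) = j x := fun x =>
    j.liftNormal_commutes (AlgebraicClosure F) x
  let σ : AlgebraicClosure F ≃ₐ[F] AlgebraicClosure F :=
    AlgEquiv.ofBijective σ₀ (Algebra.IsAlgebraic.algHom_bijective σ₀)
  refine ⟨(absoluteGaloisGroup.toAlgEquiv F).symm σ, ?_⟩
  rw [MulEquiv.apply_symm_apply]
  apply le_antisymm
  · intro a ha
    rw [IntermediateField.mem_map]
    set b : embField F M := ⟨a, ha⟩
    refine ⟨((equivEmbField F M).symm b : M), ((equivEmbField F M).symm b).2, ?_⟩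
    change σ₀ _ = a
    rw [hσ₀, hj, AlgEquiv.apply_symm_apply]
  · intro a ha
    rw [IntermediateField.mem_map] at ha
    obtain ⟨x, hx, rfl⟩ := ha
    change σ₀ x ∈ embField F M
    rw [show (x : AlgebraicClosure F) = ((⟨x, hx⟩ : M) : AlgebraicClosure F) from rfl, hσ₀, hj]
    exact SetLike.coe_mem _

end EmbField

end LocalWeilDatum

/-! ### The image of `W_E → W_F` -/

section Restrict

open LocalWeilDatum

variable (F E : Type*) [Field F] [ValuativeRel F] [TopologicalSpace F] [IsNonarchimedeanLocalField F]
  [Field E] [ValuativeRel E] [TopologicalSpace E] [IsNonarchimedeanLocalField E]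
  [Algebra F E] [FiniteDimensional F E] [ValuativeExtension F E]

variable {F E} in
/-- Transport of Frobenius congruences from `F̄` to `Ē` (converse of
`isFrobPow_absGaloisRestrict_of_forall`): if `res τ • x ≡ x ^ (q_F ^ (f k)) (mod 𝔓_F)` on `S_F`
and `q_E = q_F ^ f`, then `τ • y ≡ y ^ (q_E ^ k) (mod 𝔓_E)` on `S_E` — the embedding
`ι : F̄ → Ē` is bijective (`E/F` algebraic) and identifies `S_F, 𝔓_F` with `S_E, 𝔓_E`
(`absClosureEmbedding_mem_absIntegers_iff`, `absClosureEmbedding_mem_absMaximalIdeal_iff`).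
[cite: Corvallis1979, (1.4.5)] -/
theorem forall_smul_sub_pow_mem_of_absGaloisRestrict (τ : absoluteGaloisGroup E) (k f : ℕ)
    (hf : residueFieldCard E = residueFieldCard F ^ f)
    (hτ : ∀ x : absIntegers 𝒪[F] F,
      absGaloisRestrict F E τ • x - x ^ residueFieldCard F ^ (f * k) ∈ absMaximalIdeal F)
    (y : absIntegers 𝒪[E] E) :
    τ • y - y ^ residueFieldCard E ^ k ∈ absMaximalIdeal E := by
  set ι := absClosureEmbedding F E with hι
  obtain ⟨a, ha⟩ := (absClosureEmbedding_bijective F E).2 (y : AlgebraicClosure E)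
  have haS : a ∈ absIntegers 𝒪[F] F := by
    rw [← absClosureEmbedding_mem_absIntegers_iff (E := E), ha]
    exact y.2
  set x : absIntegers 𝒪[F] F := ⟨a, haS⟩ with hx
  set z : absIntegers 𝒪[F] F := absGaloisRestrict F E τ • x - x ^ residueFieldCard F ^ (f * k) with hz
  have hzE : ι z ∈ absIntegers 𝒪[E] E := (absClosureEmbedding_mem_absIntegers_iff _).mpr z.2
  have key : (⟨ι z, hzE⟩ : absIntegers 𝒪[E] E) = τ • y - y ^ residueFieldCard E ^ k := by
    apply Subtype.ext
    have hy : (y : AlgebraicClosure E) = ι a := ha.symm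
    simp [z, x, ι, integralClosure.coe_smul, absGaloisRestrict_apply_smul, hf, pow_mul, hy]
  rw [← key, absClosureEmbedding_mem_absMaximalIdeal_iff z hzE]
  exact hτ x

variable {F E} in
/-- **An element of `Γ_E` restricting into `W_F` lies in `W_E`** (converse of
`WeilGroup.weilSubgroup_map_absGaloisRestrict_le`; Tate: `W_E = W_F ∩ Gal(F̄/E)` under `res`).
If `res τ ∈ W_F` has degree `n`, then `n = f k` with `f = f(E/F)` the residue degree
(`inertiaDeg_dvd_deg_of_mem_fieldSubgroup`, as `res τ ∈ W_F ∩ G_{E₀}`), `q_E = q_F ^ f`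
(`residueFieldCard_eq_pow_inertiaDeg`), and `τ` is a Frobenius power of exponent `k` for `E`
(`forall_smul_sub_pow_mem_of_absGaloisRestrict`). [cite: Corvallis1979, (1.4.5)] -/
theorem mem_weilSubgroup_of_absGaloisRestrict_mem {τ : absoluteGaloisGroup E}
    (h : absGaloisRestrict F E τ ∈ weilSubgroup F) : τ ∈ weilSubgroup E := by
  haveI := finiteDimensional_embField F E
  -- `res τ` as an element `w` of `W_F ∩ G_{E₀}`
  obtain ⟨n, hn⟩ := (mem_weilSubgroup_iff IsFrobPow.mul_holds).mp h
  set w : WeilGroup F := WeilGroup.mk (absGaloisRestrict F E τ) ⟨n, hn⟩ with hw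
  have hwγ : WeilGroup.toAbsGalois F w = absGaloisRestrict F E τ := by rw [hw, WeilGroup.toAbsGalois_mk]
  have hwn : WeilGroup.deg w = n :=
    (WeilGroup.deg_eq_iff IsFrobPow.mul_holds IsFrobPow.unique_holds).mpr (by rw [hwγ]; exact hn)
  have hwU : w ∈ fieldSubgroup F (embField F E) := by
    rw [← toAbsGalois_mem_galFixing_iff, hwγ]
    exact absGaloisRestrict_mem_galFixing F E τ
  -- `f ∣ n`
  set f := Ideal.inertiaDeg' (IsLocalRing.maximalIdeal 𝒪[F]) (primeOf F (embField F E)) with hf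
  have hqf : residueFieldCard E = residueFieldCard F ^ f := residueFieldCard_eq_pow_inertiaDeg F E
  have hdvd : (f : ℤ) ∣ n := hwn ▸ inertiaDeg_dvd_deg_of_mem_fieldSubgroup F (embField F E) hwU
  obtain ⟨k, rfl⟩ := hdvd
  -- `τ` is a Frobenius power of exponent `k`
  refine mem_weilSubgroup_of_isFrobPow (n := k) ?_
  obtain ⟨k, rfl | rfl⟩ := Int.eq_nat_or_neg k
  · rw [isFrobPow_natCast_iff]
    refine forall_smul_sub_pow_mem_of_absGaloisRestrict τ k f hqf ?_
    rw [← isFrobPow_natCast_iff, Nat.cast_mul]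
    exact hn
  · rw [isFrobPow_neg_natCast_iff, isFrobPow_natCast_iff]
    refine forall_smul_sub_pow_mem_of_absGaloisRestrict τ⁻¹ k f hqf ?_
    rw [← isFrobPow_natCast_iff, map_inv, ← isFrobPow_neg_natCast_iff]
    have e : -((f * k : ℕ) : ℤ) = (f : ℤ) * -(k : ℤ) := by push_cast; ring
    rw [e]
    exact hn

/-- **The image of `W_E → W_F` is the field subgroup `W_F ∩ G_{E₀}`** of the copy
`E₀ = embField F E ⊆ F̄` of `E` (for the inclusion hypothesis `h` of `WeilGroup.map`, supplied by
`weilSubgroup_map_absGaloisRestrict_le_holds`): the image of `res : Γ_E → Γ_F` is `G_{E₀}`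
(`absGaloisRestrict_mem_galFixing`, `exists_absGaloisRestrict_eq`), and an element of `Γ_E`
restricting into `W_F` is in `W_E` (`mem_weilSubgroup_of_absGaloisRestrict_mem`).
[cite: Corvallis1979, (1.4.5)] -/
theorem WeilGroup.range_map_eq_fieldSubgroup_embField
    (h : (weilSubgroup E).map (absGaloisRestrict F E).toMonoidHom ≤ weilSubgroup F) :
    (WeilGroup.map F E h).range = fieldSubgroup F (embField F E) := by
  ext w
  constructor
  · rintro ⟨w', rfl⟩
    rw [← toAbsGalois_mem_galFixing_iff, WeilGroup.toAbsGalois_map]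
    exact absGaloisRestrict_mem_galFixing F E _
  · intro hw
    obtain ⟨τ, hτ⟩ := exists_absGaloisRestrict_eq F E ((toAbsGalois_mem_galFixing_iff (F := F)).mpr hw)
    have hτW : τ ∈ weilSubgroup E := by
      apply mem_weilSubgroup_of_absGaloisRestrict_mem (F := F)
      rw [hτ, ← WeilGroup.range_toAbsGalois]
      exact ⟨w, rfl⟩
    refine ⟨⟨τ, hτW⟩, WeilGroup.toAbsGalois_injective (F := F) ?_⟩
    rw [WeilGroup.toAbsGalois_map, ← hτ]
    rfl

/-- The image of `W_E → W_F` is a field subgroup of `W_F` (in particular open of finite index), for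
`E/F` finite separable. [cite: Corvallis1979, (1.4.5)] -/
theorem WeilGroup.isFieldSubgroup_range_map [Algebra.IsSeparable F E]
    (h : (weilSubgroup E).map (absGaloisRestrict F E).toMonoidHom ≤ weilSubgroup F) :
    IsFieldSubgroup F (WeilGroup.map F E h).range :=
  ⟨embField F E, finiteDimensional_embField F E, embField_le_sepClosure F E,
    WeilGroup.range_map_eq_fieldSubgroup_embField F E h⟩

/-- The index of the image of `W_E → W_F` is `[E : F]` for `E/F` finite separable
(`index_fieldSubgroup_eq_finrank` for `E₀ ≅ E`). [cite: Corvallis1979, (1.4.5)] -/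
theorem WeilGroup.index_range_map [Algebra.IsSeparable F E]
    (h : (weilSubgroup E).map (absGaloisRestrict F E).toMonoidHom ≤ weilSubgroup F) :
    (WeilGroup.map F E h).range.index = Module.finrank F E := by
  haveI := finiteDimensional_embField F E
  rw [WeilGroup.range_map_eq_fieldSubgroup_embField F E h,
    index_fieldSubgroup_eq_finrank F (embField F E) (embField_le_sepClosure F E)]
  exact (LinearEquiv.finrank_eq (equivEmbField F E).toLinearEquiv).symm

end Restrict

end Literature.NumberTheory.GaloisRepresentations
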